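import Mathlib.RingTheory.MvPolynomial.Basic
import Mathlib.Algebra.MvPolynomial.Degrees
import Literature.Computability.Complexity.MultilinearExtension
import HarnessLib

/-!
# Oracle computations are low-degree polynomials in the oracle bits (Fenner–Fortnow–Kurtz–Li, Lemma 6.12)

Topic `Literature/Computability/Complexity` (transcript model of oracle algorithms, `Oracle.lean`).
Fenner–Fortnow–Kurtz–Li, *An oracle builder's toolkit*, Inform. and Comput. 182 (2003),
**Lemma 6.12** (p. 31): "For every `GapP^y` function `g` defined by machine `M` running in time
`nᵏ` and string `x` of length `n`, there is a polynomial `h` with integer coefficients of degree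
bounded by `nᵏ` such that `g_x(y) = h(y)` for all `y ∈ {0,1}^{2^{nᵏ+1}-1}`" (proof: "Modify `M`
so that it guesses the query answers before its computation and then verifies its answers at the
end"; each path `p` contributes `t_p = ± ∏ᵢ t_{i,p}` with `t_{i,p} ∈ {y_w, 1 - y_w, 1}`, and
`h = ∑_p t_p`). The same statement for deterministic oracle machines is Ko 1989, Lemma 2.1 (an
`OR` of `AND`s over the accepting paths) read arithmetically, and for quantum query algorithms it
is Beals et al.'s Lemma 4.2; it is the degree hypothesis of Nisan–Szegedy's theorem in "AWPP has
polynomial certificate complexity" (ibid. Thm. 6.13; `ApproxDegreeCertificates.lean`).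

This file proves it in the tree's transcript model (`OracleAlg`, `runAux`: a step function
`(input, answers so far) ↦ query | output`, run with fuel `k`), for oracles whose answer to each
query is either a designated WINDOW VARIABLE or a CONSTANT — a *view*
`v : List Bool → Fin W ⊕ Bool` (`OracleAlg.viewBit`, `OracleAlg.viewOracle`; e.g. a background
language patched on an injectively addressed window, the shape of all finite-extension and
certificate arguments):

* `OracleAlg.atomPoly a b` — the polynomial of the event "the atom `a` reads the bit `b`":
  `Xᵢ` / `1 - Xᵢ` for a window variable, the constant `[c = b]` otherwise (total degree `≤ 1`);
* `OracleAlg.accPoly M v z k ans` — the ACCEPTANCE POLYNOMIAL of the run of `M` on `z` with fuel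
  `k` from the transcript `ans`: by recursion on the fuel, a query `y` contributes
  `atomPoly (v y) 1 · accPoly(… ans·1) + atomPoly (v y) 0 · accPoly(… ans·0)` ("guess the answer,
  verify at the end"), an output contributes its truth value;
* PROVED: `OracleAlg.eval_accPoly` — at every Boolean point `w` it evaluates to
  `[M.runAux (viewOracle v w) z k ans = some true]`, and `OracleAlg.totalDegree_accPoly_le` — its
  total degree is at most the fuel `k` (one factor of degree `≤ 1` per round);
* `OracleAlg.countPoly` — the sum of acceptance polynomials over a finite family of inputs (the
  witnesses `y ∈ {0,1}^m` of a `#P`-style count), evaluating to the NUMBER of accepted inputs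
  (`eval_countPoly`) with total degree `≤ k` (`totalDegree_countPoly_le`); differences of two such
  (`GapP`-style gaps) keep the degree bound (`totalDegree_sub`, recorded as `eval_gapPoly`,
  `totalDegree_gapPoly_le`).

Coefficients live in an arbitrary nontrivial commutative ring `R` (`ℤ` as printed; `ℝ` for the
approximation-theoretic consumer).

## References

* [FennerFortnowKurtzLi2003IC] Lemma 6.12 (p. 31) and its proof, read via
  `lit read doi:10.1016/s0890-5401(03)00018-x --pages 25-34`.
* [Ko1989] K.-I Ko, *Constructing oracles by lower bound techniques for circuits*, Lemma 2.1
  (accepting paths `π` with query sets `Y_π`, `N_π`).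
* [BealsEtAl2001] Lemma 4.2 (the quantum analogue: amplitudes are polynomials of degree `≤ T`).
-/

noncomputable section

namespace Literature.Computability.Complexity

open _root_.Computability MvPolynomial Finset

namespace OracleAlg

variable {R : Type*} [CommRing R] {W : ℕ}

/-! ### Views: oracle bits as window variables or constants -/

/-- The bit read by the query `y` under the view `v` at the window `w`: the window variable
`w i` if `v y = inl i`, the constant `c` if `v y = inr c`. [cite: FennerFortnowKurtzLi2003IC, Lemma 6.12 (p. 31)] -/
def viewBit (v : List Bool → Fin W ⊕ Bool) (w : Fin W → Bool) (y : List Bool) : Bool :=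
  Sum.elim w id (v y)

/-- The oracle presented by the view `v` at the window `w` (answers coded by `encodeBool`, as for
`Oracle.ofLanguage`). [cite: FennerFortnowKurtzLi2003IC, Lemma 6.12 (p. 31)] -/
def viewOracle (v : List Bool → Fin W ⊕ Bool) (w : Fin W → Bool) : Oracle :=
  fun y => encodeBool (viewBit v w y)

/-- Unfolding: a window query reads its variable. [folklore] -/
theorem viewBit_of_inl {v : List Bool → Fin W ⊕ Bool} {y : List Bool} {i : Fin W} (h : v y = Sum.inl i)
    (w : Fin W → Bool) : viewBit v w y = w i := by
  simp [viewBit, h]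

/-- Unfolding: a constant query reads its constant. [folklore] -/
theorem viewBit_of_inr {v : List Bool → Fin W ⊕ Bool} {y : List Bool} {c : Bool} (h : v y = Sum.inr c)
    (w : Fin W → Bool) : viewBit v w y = c := by
  simp [viewBit, h]

/-! ### Atoms -/

/-- The polynomial of the event "the atom `a` reads the bit `b`": `Xᵢ` (resp. `1 - Xᵢ`) for the
window variable `i` and `b = 1` (resp. `0`); the constant `[c = b]` for a constant atom `c`
(the factors `t_{i,p} ∈ {y_w, 1 - y_w, 1}` of the printed proof, with `0` for an inconsistent
guess). [cite: FennerFortnowKurtzLi2003IC, Lemma 6.12 (proof, p. 31)] -/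
def atomPoly (a : Fin W ⊕ Bool) (b : Bool) : MvPolynomial (Fin W) R :=
  match a with
  | Sum.inl i => if b then X i else 1 - X i
  | Sum.inr c => if c = b then 1 else 0

/-- At a Boolean point the atom polynomial is the indicator of "the atom reads `b`". [cite: FennerFortnowKurtzLi2003IC, Lemma 6.12 (proof, p. 31)] -/
theorem eval_atomPoly (a : Fin W ⊕ Bool) (b : Bool) (w : Fin W → Bool) :
    MvPolynomial.eval (Multilinear.boolPt (R := R) w) (atomPoly a b) =
      if Sum.elim w id a = b then 1 else 0 := by
  rcases a with i | c
  · cases b <;> cases hw : w i <;> simp [atomPoly, hw]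
  · simp only [atomPoly, Sum.elim_inr, id_eq]
    split_ifs <;> simp

/-- Atom polynomials have total degree at most `1`. [cite: FennerFortnowKurtzLi2003IC, Lemma 6.12 (proof, p. 31)] -/
theorem totalDegree_atomPoly_le [Nontrivial R] (a : Fin W ⊕ Bool) (b : Bool) :
    (atomPoly (R := R) a b).totalDegree ≤ 1 := by
  rcases a with i | c
  · cases b
    · simp only [atomPoly]
      refine (totalDegree_sub _ _).trans (max_le (by simp) ?_)
      rw [totalDegree_X]
    · simp only [atomPoly, ite_true, totalDegree_X, le_refl]
  · simp only [atomPoly]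
    split_ifs <;> simp

/-! ### The acceptance polynomial of a run -/

/-- **The acceptance polynomial** of the run of `M` on input `z` with fuel `k` from the answer
transcript `ans`, under the view `v`: an output contributes its truth value; a query `y` branches
on the guessed answer, each branch weighted by the atom polynomial of "`y` reads that answer"
("guess the query answers before the computation and verify them at the end").
[cite: FennerFortnowKurtzLi2003IC, Lemma 6.12 (proof, p. 31)] [cite: Ko1989, Lemma 2.1] -/
def accPoly (M : OracleAlg Bool) (v : List Bool → Fin W ⊕ Bool) (z : List Bool) :
    ℕ → List (List Bool) → MvPolynomial (Fin W) R
  | 0, _ => 0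
  | k + 1, ans =>
    match M.step z ans with
    | Sum.inr b => if b = true then 1 else 0
    | Sum.inl y =>
      atomPoly (v y) true * accPoly M v z k (ans ++ [encodeBool true]) +
        atomPoly (v y) false * accPoly M v z k (ans ++ [encodeBool false])

/-- **The acceptance polynomial computes acceptance**: at the Boolean point `w` it evaluates to
`1` if `M` with the oracle `viewOracle v w` outputs `true` within `k` rounds from `ans`, and to `0`
otherwise. [cite: FennerFortnowKurtzLi2003IC, Lemma 6.12 (p. 31)] [cite: Ko1989, Lemma 2.1 (c)] -/
theorem eval_accPoly (M : OracleAlg Bool) (v : List Bool → Fin W ⊕ Bool) (z : List Bool)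
    (w : Fin W → Bool) :
    ∀ (k : ℕ) (ans : List (List Bool)),
      MvPolynomial.eval (Multilinear.boolPt (R := R) w) (accPoly M v z k ans) =
        if M.runAux (viewOracle v w) z k ans = some true then 1 else 0
  | 0, ans => by simp [accPoly]
  | k + 1, ans => by
    rw [runAux_succ]
    unfold accPoly
    cases hs : M.step z ans with
    | inr b =>
      cases b <;> simp
    | inl y =>
      simp only [map_add, map_mul, eval_atomPoly, eval_accPoly M v z w k]
      cases hb : viewBit v w y
      · have hO : viewOracle v w y = encodeBool false := by
          show encodeBool (viewBit v w y) = _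
          rw [hb]
        have hb' : Sum.elim w id (v y) = false := hb
        simp [hO, hb']
      · have hO : viewOracle v w y = encodeBool true := by
          show encodeBool (viewBit v w y) = _
          rw [hb]
        have hb' : Sum.elim w id (v y) = true := hb
        simp [hO, hb']

/-- **The degree bound**: the acceptance polynomial of a run with fuel `k` has total degree at
most `k` (one atom of degree `≤ 1` per round). [cite: FennerFortnowKurtzLi2003IC, Lemma 6.12 (p. 31)] -/
theorem totalDegree_accPoly_le [Nontrivial R] (M : OracleAlg Bool) (v : List Bool → Fin W ⊕ Bool)
    (z : List Bool) :
    ∀ (k : ℕ) (ans : List (List Bool)), (accPoly (R := R) M v z k ans).totalDegree ≤ k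
  | 0, ans => by simp [accPoly]
  | k + 1, ans => by
    unfold accPoly
    cases M.step z ans with
    | inr b =>
      cases b <;> simp
    | inl y =>
      refine (totalDegree_add _ _).trans (max_le ?_ ?_) <;>
        refine (totalDegree_mul _ _).trans ?_ <;>
        { have h1 := totalDegree_atomPoly_le (R := R) (v y)
          have h2 := totalDegree_accPoly_le M v z k
          first
            | exact Nat.add_le_add (h1 true) (h2 _) |>.trans (by omega)
            | exact Nat.add_le_add (h1 false) (h2 _) |>.trans (by omega) }

/-- The run-level form: `eval_accPoly` for `M.run` (empty initial transcript). [cite: FennerFortnowKurtzLi2003IC, Lemma 6.12 (p. 31)] -/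
theorem eval_accPoly_nil (M : OracleAlg Bool) (v : List Bool → Fin W ⊕ Bool) (z : List Bool)
    (w : Fin W → Bool) (k : ℕ) :
    MvPolynomial.eval (Multilinear.boolPt (R := R) w) (accPoly M v z k []) =
      if M.run (viewOracle v w) k z = some true then 1 else 0 :=
  eval_accPoly M v z w k []

/-! ### Counting and gap polynomials -/

/-- The COUNTING POLYNOMIAL of `M` over a finite family of inputs `inp : ι → {0,1}*` (e.g. the
pairs `⟨x, y⟩`, `y ∈ {0,1}^m`, of a `#P^O` count) with fuel `k`: the sum of the acceptance
polynomials. [cite: FennerFortnowKurtzLi2003IC, Lemma 6.12 (p. 31, "h = Σ_p t_p")] -/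
def countPoly {ι : Type*} [Fintype ι] (M : OracleAlg Bool) (v : List Bool → Fin W ⊕ Bool)
    (k : ℕ) (inp : ι → List Bool) : MvPolynomial (Fin W) R :=
  ∑ j, accPoly M v (inp j) k []

/-- **The counting polynomial counts**: at the Boolean point `w` it evaluates to the number of
inputs of the family accepted by `M` with the oracle `viewOracle v w` within `k` rounds.
[cite: FennerFortnowKurtzLi2003IC, Lemma 6.12 (p. 31)] -/
theorem eval_countPoly {ι : Type*} [Fintype ι] (M : OracleAlg Bool) (v : List Bool → Fin W ⊕ Bool)
    (k : ℕ) (inp : ι → List Bool) (w : Fin W → Bool) :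
    MvPolynomial.eval (Multilinear.boolPt (R := R) w) (countPoly M v k inp) =
      ((univ.filter fun j => M.run (viewOracle v w) k (inp j) = some true).card : R) := by
  classical
  unfold countPoly
  rw [map_sum, Finset.sum_congr rfl fun j _ => eval_accPoly_nil (R := R) M v (inp j) w k,
    Finset.natCast_card_filter]

/-- The counting polynomial has total degree at most the fuel. [cite: FennerFortnowKurtzLi2003IC, Lemma 6.12 (p. 31)] -/
theorem totalDegree_countPoly_le [Nontrivial R] {ι : Type*} [Fintype ι] (M : OracleAlg Bool)
    (v : List Bool → Fin W ⊕ Bool) (k : ℕ) (inp : ι → List Bool) :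
    (countPoly (R := R) M v k inp).totalDegree ≤ k := by
  unfold countPoly
  refine (totalDegree_finsetSum _ _).trans (Finset.sup_le fun j _ => ?_)
  exact totalDegree_accPoly_le M v (inp j) k []

/-- The GAP POLYNOMIAL of two machines (a `GapP^O`-style difference of two counts, possibly with
different fuels and witness families). [cite: FennerFortnowKurtzLi2003IC, Lemma 6.12 (p. 31) and Def. 6.1] -/
def gapPoly {ι₁ ι₂ : Type*} [Fintype ι₁] [Fintype ι₂] (M₁ M₂ : OracleAlg Bool)
    (v : List Bool → Fin W ⊕ Bool) (k₁ k₂ : ℕ) (inp₁ : ι₁ → List Bool) (inp₂ : ι₂ → List Bool) :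
    MvPolynomial (Fin W) R :=
  countPoly M₁ v k₁ inp₁ - countPoly M₂ v k₂ inp₂

/-- The gap polynomial evaluates to the difference of the two counts. [cite: FennerFortnowKurtzLi2003IC, Lemma 6.12 (p. 31)] -/
theorem eval_gapPoly {ι₁ ι₂ : Type*} [Fintype ι₁] [Fintype ι₂] (M₁ M₂ : OracleAlg Bool)
    (v : List Bool → Fin W ⊕ Bool) (k₁ k₂ : ℕ) (inp₁ : ι₁ → List Bool) (inp₂ : ι₂ → List Bool)
    (w : Fin W → Bool) :
    MvPolynomial.eval (Multilinear.boolPt (R := R) w) (gapPoly M₁ M₂ v k₁ k₂ inp₁ inp₂) =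
      ((univ.filter fun j => M₁.run (viewOracle v w) k₁ (inp₁ j) = some true).card : R) -
        ((univ.filter fun j => M₂.run (viewOracle v w) k₂ (inp₂ j) = some true).card : R) := by
  unfold gapPoly
  rw [map_sub, eval_countPoly, eval_countPoly]

/-- The gap polynomial has total degree at most the larger fuel. [cite: FennerFortnowKurtzLi2003IC, Lemma 6.12 (p. 31)] -/
theorem totalDegree_gapPoly_le [Nontrivial R] {ι₁ ι₂ : Type*} [Fintype ι₁] [Fintype ι₂]
    (M₁ M₂ : OracleAlg Bool) (v : List Bool → Fin W ⊕ Bool) (k₁ k₂ : ℕ) (inp₁ : ι₁ → List Bool)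
    (inp₂ : ι₂ → List Bool) :
    (gapPoly (R := R) M₁ M₂ v k₁ k₂ inp₁ inp₂).totalDegree ≤ max k₁ k₂ := by
  unfold gapPoly
  refine (totalDegree_sub _ _).trans (max_le_max ?_ ?_)
  · exact totalDegree_countPoly_le M₁ v k₁ inp₁
  · exact totalDegree_countPoly_le M₂ v k₂ inp₂

end OracleAlg

end Literature.Computability.Complexity

end
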